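import Literature.AlgebraicGeometry.Resolution.NearPointsChart
import Literature.AlgebraicGeometry.Resolution.InitialFormsChangeOfParameters
import Literature.AlgebraicGeometry.Resolution.RsopMonomialIdeals
import HarnessLib

/-!
# Near points over a curve centre force `τ(x) ≤ 1` (CoP1, Lemma 4.3 (2), local-ring form)

Topic: `Literature/AlgebraicGeometry/Resolution`. [CoP1] = Cossart–Piltant, J. Algebra 320
(2008), Lemma 4.3 (2), p. 8: "If `τ(x) = 2` and `Y` is a curve, then no `x′ ∈ q⁻¹(x)` is near
`x`. … (2) follows easily from (10) and (11)." Here (10) is "`in_x f ∈ k(x)[Y_1, …, Y_r]`" for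
the permissible centre `Y = V(y_1, …, y_r)`, `(y_1, …, y_r, …)` a regular system of parameters
at `x`, and (11) the congruence for the weak transform on the charts. PROVED at the level of the
regular local ring `R = 𝒪_{X,x}`: the initial forms `cl_μ(J)` with respect to a full regular
system of parameters `c̃` come, by (10), from forms in the two centre variables
(`initialForms_le_map_rename`, using `InitialFormsAlongCentre`-style uniqueness of initial forms,
Matsumura 17.10), and for those the chart computation `NearPointsChart.lean` applies:

* `initialForms_comp_map_rename_le`, `initialForms_le_map_rename`, `initialForms_eq_map_rename`
  — **(10): `cl_μ(J)` (w.r.t. `c̃`) is the image of `cl_μ(J)` w.r.t. the centre parameters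
  `c̃ ∘ ι` under `Y_i ↦ Y_{ι i}`, when `J ⊆ P^μ`, `P = (c̃_{ι 1}, c̃_{ι 2})`;**
* `exists_forall_mem_initialForms_rsop_eq_C_mul_pow`, `hironakaTauAt_le_one_of_near` — **if a
  point `𝔴 ⊇ 𝔪 B_j` of the chart of the blowing up along `P` is near (every `F(e)`,
  `F` a form of degree `μ` with `F(c̃ ∘ ι) ∈ J`, lies in `𝔴^μ (B_j)_𝔴`), then every initial
  form is `c_G (Y_{ι l} − a Y_{ι j})^μ` for one `a ∈ k(x)`, and `τ(x) ≤ 1`;**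
* `hironakaTauAt_le_one_of_near_of_isRsopPart` — the same for a centre `P = (c_1, c_2)` given
  by any pair that is part of a regular system of parameters, and `τ` computed in any regular
  system of parameters (`hironakaTauAt_eq_of_rsop`).

So `τ(x) = 2` excludes near points over `x` when `Y` is a curve; the scheme-level statement is
assembled from `IsBlowup.exists_reesChart_stalk` in a later file.

## Sources

* V. Cossart, O. Piltant, J. Algebra 320 (2008) 1051–1082, Lemma 4.3 (2) with (10)–(11), p. 8.
  [CossartPiltant2008]
* H. Matsumura, Commutative Ring Theory (1986), Thm. 14.2, 16.2, 17.10 — background.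
-/

noncomputable section

open IsLocalRing MvPolynomial

namespace Literature.AlgebraicGeometry.Resolution

universe u

/-! ## (10): initial forms come from forms in the centre variables -/

section LocalRing

variable {R : Type u} [CommRing R] [IsLocalRing R] {d r : ℕ} (c : Fin d → R) (ι : Fin r → Fin d)

/-- Initial forms with respect to a sub-family `c ∘ ι` give initial forms with respect to `c`
under the renaming `Y_i ↦ Y_{ι i}`. [folklore] -/
theorem initialForms_comp_map_rename_le (J : Ideal R) (μ : ℕ) :
    (initialForms (c ∘ ι) J μ).map
        (rename ι : MvPolynomial (Fin r) (ResidueField R) →ₐ[ResidueField R]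
          MvPolynomial (Fin d) (ResidueField R)).toLinearMap ≤
      initialForms c J μ := by
  rintro G ⟨G₂, hG₂, rfl⟩
  obtain ⟨F, hF, hFJ, rfl⟩ := (mem_initialForms_iff (c ∘ ι)).mp hG₂
  refine (mem_initialForms_iff c).mpr ⟨rename ι F, hF.rename_isHomogeneous, ?_, ?_⟩
  · rw [eval_rename]
    exact hFJ
  · rw [map_rename]
    rfl

end LocalRing

section Regular

variable {R : Type u} [CommRing R] [IsRegularLocalRing R] {d r : ℕ}
  (hd : (maximalIdeal R).spanFinrank = d) (c : Fin d → R)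
  (hc : Ideal.span (Set.range c) = maximalIdeal R) (ι : Fin r → Fin d)

include hd hc in
/-- **[CoP1] (10), `in_x f ∈ k(x)[Y_1, …, Y_r]`, as an equality of spaces of initial forms**:
if `J ⊆ P^μ` for the centre ideal `P = (c_{ι i})` generated by part of the regular system of
parameters `c`, then every initial form of `J` with respect to `c` is the renaming of an
initial form with respect to `c ∘ ι` (an `f ∈ J` is `F(c ∘ ι)` for a form `F` of degree `μ`,
and initial forms of degree `μ` are well defined, Matsumura 17.10).
[cite: CossartPiltant2008, proof of Prop. 4.2, (10)] -/
theorem initialForms_le_map_rename {J : Ideal R} {μ : ℕ}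
    (hJ : J ≤ Ideal.span (Set.range (c ∘ ι)) ^ μ) :
    initialForms c J μ ≤ (initialForms (c ∘ ι) J μ).map
      (rename ι : MvPolynomial (Fin r) (ResidueField R) →ₐ[ResidueField R]
        MvPolynomial (Fin d) (ResidueField R)).toLinearMap := by
  intro G hG
  obtain ⟨F', hF', hF'J, rfl⟩ := (mem_initialForms_iff c).mp hG
  by_cases hG0 : MvPolynomial.map (residue R) F' = 0
  · rw [hG0]
    exact Submodule.zero_mem _
  obtain ⟨F, hF, hFf⟩ := exists_isHomogeneous_of_mem_span_pow (c ∘ ι) μ (hJ hF'J)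
  have hF'' : (rename ι F).IsHomogeneous μ := hF.rename_isHomogeneous
  have heval : eval c (rename ι F) = eval c F' := by rw [eval_rename, hFf]
  have hF''0 : MvPolynomial.map (residue R) (rename ι F) ≠ 0 := by
    intro h0
    apply hG0
    refine map_residue_eq_zero_of_eval_mem_pow_succ hd c hc hF' ?_
    rw [← heval]
    exact eval_mem_pow_succ_of_map_residue_eq_zero c hc hF'' h0
  have heq := (map_residue_eq_of_eval_eq hd c hc hF'' hF' hF''0 hG0 heval).2
  refine ⟨MvPolynomial.map (residue R) F, (mem_initialForms_iff (c ∘ ι)).mpr ⟨F, hF, ?_, rfl⟩, ?_⟩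
  · rw [hFf]
    exact hF'J
  · change rename ι (MvPolynomial.map (residue R) F) = _
    rw [← map_rename, heq]

include hd hc in
/-- Hence equality: `cl_μ(J)` with respect to `c` is the renamed `cl_μ(J)` with respect to the
centre parameters. [cite: CossartPiltant2008, proof of Prop. 4.2, (10)] -/
theorem initialForms_eq_map_rename {J : Ideal R} {μ : ℕ}
    (hJ : J ≤ Ideal.span (Set.range (c ∘ ι)) ^ μ) :
    initialForms c J μ = (initialForms (c ∘ ι) J μ).map
      (rename ι : MvPolynomial (Fin r) (ResidueField R) →ₐ[ResidueField R]
        MvPolynomial (Fin d) (ResidueField R)).toLinearMap :=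
  le_antisymm (initialForms_le_map_rename hd c hc ι hJ) (initialForms_comp_map_rename_le c ι J μ)

end Regular

/-! ## Lemma 4.3 (2): near points over a curve centre give `τ ≤ 1` -/

section Curve

variable {R : Type u} [CommRing R] [IsRegularLocalRing R] {d : ℕ}
  (hd : (maximalIdeal R).spanFinrank = d) (c : Fin d → R)
  (hc : Ideal.span (Set.range c) = maximalIdeal R) {ι : Fin 2 → Fin d}
  (hι : Function.Injective ι) (j : Fin 2) {l : Fin 2} (hl : l ≠ j)

include hd hc hι hl in
/-- **[CoP1] Lemma 4.3 (2), the initial forms at a near point over a curve centre.** Let `c` be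
a regular system of parameters of `R`, `P = (c_{ι 1}, c_{ι 2})` the ideal of the centre (a curve
through the closed point, `ι` injective), `J ⊆ P^μ`, `μ ≥ 1`, and `𝔴 ⊇ 𝔪 B_j` a prime of the
`j`-th chart of the blowing up along `P` at which every weak transform `F(e)`, `F` a form of
degree `μ` with `F(c ∘ ι) ∈ J`, lies in `𝔴^μ (B_j)_𝔴` (the point is near). Then for one
`a ∈ k`, every initial form of `J` is `c_G (Y_{ι l} − a Y_{ι j})^μ`.
[cite: CossartPiltant2008, Lemma 4.3 (2)] -/
theorem exists_forall_mem_initialForms_rsop_eq_C_mul_pow {J : Ideal R} {μ : ℕ} (hμ : 1 ≤ μ)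
    (hJ : J ≤ Ideal.span (Set.range (c ∘ ι)) ^ μ)
    (𝔴 : Ideal (chartRing (c ∘ ι) j)) [𝔴.IsPrime]
    (h𝔴 : (maximalIdeal R).map (chartBase (c ∘ ι) j) ≤ 𝔴)
    (hnear : ∀ F : MvPolynomial (Fin 2) R, F.IsHomogeneous μ → MvPolynomial.eval (c ∘ ι) F ∈ J →
      (algebraMap (chartRing (c ∘ ι) j) (Localization.AtPrime 𝔴) :
          chartRing (c ∘ ι) j →+* Localization.AtPrime 𝔴)
          (MvPolynomial.eval₂Hom (chartBase (c ∘ ι) j) (fun i => chartGen (c ∘ ι) j i) F) ∈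
        maximalIdeal (Localization.AtPrime 𝔴) ^ μ) :
    ∃ a : ResidueField R, ∀ G ∈ initialForms c J μ, ∃ c₀ : ResidueField R,
      G = C c₀ * (X (ι l) - C a * X (ι j)) ^ μ := by
  have hcq : IsQuasiRegular (c ∘ ι) := isQuasiRegular_rsop_comp hd c hc ι hι
  have hcm : ∀ i, (c ∘ ι) i ∈ maximalIdeal R := fun i => hc ▸ Ideal.subset_span ⟨ι i, rfl⟩
  obtain ⟨a, ha⟩ :=
    exists_forall_mem_initialForms_eq_C_mul_pow (c ∘ ι) j hl hcq hcm 𝔴 h𝔴 hμ hnear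
  refine ⟨a, fun G hG => ?_⟩
  obtain ⟨G₂, hG₂, rfl⟩ := initialForms_le_map_rename hd c hc ι hJ hG
  obtain ⟨c₀, rfl⟩ := ha G₂ hG₂
  refine ⟨c₀, ?_⟩
  change rename ι (C c₀ * (X l - C a * X j) ^ μ) = _
  simp only [map_mul, map_pow, map_sub, rename_C, rename_X]

include hd hc hι hl in
/-- **[CoP1] Lemma 4.3 (2): a near point over a curve centre forces `τ(x) ≤ 1`** (so if
`τ(x) = 2` and `Y` is a curve, no point over `x` is near). [cite: CossartPiltant2008, Lemma 4.3 (2)] -/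
theorem hironakaTauAt_le_one_of_near {J : Ideal R} {μ : ℕ} (hμ : 1 ≤ μ)
    (hJ : J ≤ Ideal.span (Set.range (c ∘ ι)) ^ μ)
    (𝔴 : Ideal (chartRing (c ∘ ι) j)) [𝔴.IsPrime]
    (h𝔴 : (maximalIdeal R).map (chartBase (c ∘ ι) j) ≤ 𝔴)
    (hnear : ∀ F : MvPolynomial (Fin 2) R, F.IsHomogeneous μ → MvPolynomial.eval (c ∘ ι) F ∈ J →
      (algebraMap (chartRing (c ∘ ι) j) (Localization.AtPrime 𝔴) :
          chartRing (c ∘ ι) j →+* Localization.AtPrime 𝔴)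
          (MvPolynomial.eval₂Hom (chartBase (c ∘ ι) j) (fun i => chartGen (c ∘ ι) j i) F) ∈
        maximalIdeal (Localization.AtPrime 𝔴) ^ μ) :
    hironakaTauAt c J μ ≤ 1 := by
  obtain ⟨a, ha⟩ :=
    exists_forall_mem_initialForms_rsop_eq_C_mul_pow hd c hc hι j hl hμ hJ 𝔴 h𝔴 hnear
  exact hironakaTau_le_one_of_forall_eq_C_mul_pow (ResidueField R) (ι l) (ι j) a μ ha

end Curve

section RsopPart

variable {R : Type u} [CommRing R] [IsLocalRing R]

/-- **[CoP1] Lemma 4.3 (2), for a centre given by a pair `c = (c_1, c_2)` that is part of a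
regular system of parameters**, with `τ` computed in an arbitrary regular system of parameters
`x` of `R`: if `J ⊆ (c)^μ`, `μ ≥ 1`, and a point `𝔴 ⊇ 𝔪 B_j` of a chart of the blowing up along
`(c)` is near, then `τ ≤ 1`. [cite: CossartPiltant2008, Lemma 4.3 (2)] -/
theorem hironakaTauAt_le_one_of_near_of_isRsopPart {c : Fin 2 → R} (hcr : IsRsopPart c)
    (j : Fin 2) {J : Ideal R} {μ : ℕ} (hμ : 1 ≤ μ) (hJ : J ≤ Ideal.span (Set.range c) ^ μ)
    (𝔴 : Ideal (chartRing c j)) [𝔴.IsPrime] (h𝔴 : (maximalIdeal R).map (chartBase c j) ≤ 𝔴)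
    (hnear : ∀ F : MvPolynomial (Fin 2) R, F.IsHomogeneous μ → MvPolynomial.eval c F ∈ J →
      (algebraMap (chartRing c j) (Localization.AtPrime 𝔴) :
          chartRing c j →+* Localization.AtPrime 𝔴)
          (MvPolynomial.eval₂Hom (chartBase c j) (fun i => chartGen c j i) F) ∈
        maximalIdeal (Localization.AtPrime 𝔴) ^ μ)
    {d : ℕ} (hd : (maximalIdeal R).spanFinrank = d) (x : Fin d → R)
    (hx : Ideal.span (Set.range x) = maximalIdeal R) :
    hironakaTauAt x J μ ≤ 1 := by
  haveI := hcr.isRegularLocalRing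
  obtain ⟨e, x', hd', hx', hx'c⟩ := hcr.exists_rsop
  have hcomp : x' ∘ Fin.castAdd e = c := funext hx'c
  subst hcomp
  -- the other index
  obtain ⟨l, hl⟩ : ∃ l : Fin 2, l ≠ j := ⟨j + 1, by fin_cases j <;> decide⟩
  have h1 := hironakaTauAt_le_one_of_near hd' x' hx' (Fin.castAdd_injective 2 e) j hl hμ hJ 𝔴 h𝔴
    hnear
  obtain rfl : d = 2 + e := hd.symm.trans hd'
  rwa [hironakaTauAt_eq_of_rsop hd hx hx' J μ] at h1

end RsopPart

end Literature.AlgebraicGeometry.Resolution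

end
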